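import Mathlib
import Summits.ValiantsHypothesis.ValiantsHypothesis.Theorems.LiouvilleSarnakCutRankWindow

/-!
# Route LiouvilleSarnak — crux `LiouvilleCutRank` (stmt-ValiantsHypothesis-14775), line
# `one_scale`: the registered stub `stub_balancedWindow`

The registered skeleton `Cruxes/LiouvilleCutRank/Lines/one_scale.lean`
(line-writer `linewriter-valiant-liouvmonotone-1-g0`, 2026-08-31) cuts the crux `LiouvilleCutRank`
(for every `W`, eventually every balanced digital cut matrix `(λ(N_π(r,c) + 1))_{r,c}` of the
Liouville function has rank `≥ W`) into a scale transfer (Stubs 1–2, provable now) and the open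
one-scale statement (Stub 3).  This file proves Stub 1, `stub_balancedWindow`, with EXACTLY the
registered signature (the skeleton closes its `sorry` by the term `stub_balancedWindow` of this
namespace):

for `n₁ · n₁ ≤ n`, every balanced cut `π : Fin n ⊕ Fin n ≃ Fin (2n)` with row/column word `w`
(`w j = true` iff position `j < 2n` is a row bit) has a window `s, …, s + 2n₁ - 1 < 2n` containing
exactly `n₁` row bits.

Proof: the instance `K = 2n₁`, `c = n₁ - 1` of the tree's counting lemma
`LiouvilleSarnakCutRankWindow.exists_window_count_btwn` — with `n = q n₁ + t`, `t < n₁ ≤ q`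
(from `n₁² ≤ n`), its smallness hypothesis reads `(n₁ - 1) q + min(2t, n₁ - 1) < q n₁ + t`, and its
conclusion `n₁ - 1 < # < 2n₁ - (n₁ - 1)` forces `# = n₁`; the balance hypotheses are the tree's
`LiouvilleSarnakCutRankFour.le_count_isLeft / le_count_not_isLeft` transported along `w`.
(`n₁ = 0`: the empty window at `s = 0`.)

Honest framing: word-combinatorial bookkeeping for a registered line of an OPEN crux; the one-scale
stub `stub_rankAtOneScale`, the crux `LiouvilleCutRank` (every `W`; rungs `W ≤ 8` are in the tree),
`DigitalBilinearLiouville` and `AlgebraicSarnak` stay open, and nothing here bears on VP versus VNP.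
No definitions.
-/

-- the directory `ValiantsHypothesis/ValiantsHypothesis` repeats the summit name (tree layout)
set_option linter.dupNamespace false

namespace Summit.ValiantsHypothesis.ValiantsHypothesis.Theorems.LiouvilleSarnakLiouvilleCutRank.OneScale

open Summit.ValiantsHypothesis.ValiantsHypothesis.Theorems.LiouvilleSarnakCutRankFour
  (le_count_isLeft le_count_not_isLeft)
open Summit.ValiantsHypothesis.ValiantsHypothesis.Theorems.LiouvilleSarnakCutRankWindow
  (exists_window_count_btwn)

/-- The row/column word `w` of a cut `π` (any `w : ℕ → Bool` agreeing with `isLeft ∘ π.symm` below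
`2n`) is `true` at no fewer than `n` positions `< 2n`. [folklore] -/
theorem le_count_word_true (n : ℕ) (π : Fin n ⊕ Fin n ≃ Fin (2 * n)) (w : ℕ → Bool)
    (hw : ∀ j : Fin (2 * n), w j = (π.symm j).isLeft) :
    n ≤ Nat.count (fun k => w k = true) (2 * n) := by
  refine (le_count_isLeft n π).trans (Nat.count_mono_left fun k hk hpk => ?_)
  rw [dif_pos hk] at hpk
  rw [hw ⟨k, hk⟩]
  exact hpk

/-- The row/column word `w` of a cut `π` is `false` at no fewer than `n` positions `< 2n`.
[folklore] -/
theorem le_count_word_false (n : ℕ) (π : Fin n ⊕ Fin n ≃ Fin (2 * n)) (w : ℕ → Bool)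
    (hw : ∀ j : Fin (2 * n), w j = (π.symm j).isLeft) :
    n ≤ Nat.count (fun k => ¬ w k = true) (2 * n) := by
  refine (le_count_not_isLeft n π).trans (Nat.count_mono_left fun k hk hpk => ?_)
  rw [dif_pos hk] at hpk
  rw [hw ⟨k, hk⟩]
  exact hpk

/-- **Stub `stub_balancedWindow` of line `one_scale` (crux `LiouvilleCutRank`,
stmt-ValiantsHypothesis-14775), PROVED — exactly the registered signature.**  For `n₁ · n₁ ≤ n`,
every balanced cut `π` of the `2n` bit positions, with row/column word `w`, has `2n₁` consecutive
positions `s, …, s + 2n₁ - 1 < 2n` containing exactly `n₁` row bits (instance `K = 2n₁`,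
`c = n₁ - 1` of `LiouvilleSarnakCutRankWindow.exists_window_count_btwn`). [folklore] -/
theorem stub_balancedWindow :
    ∀ n₁ n : ℕ, n₁ * n₁ ≤ n → ∀ (π : Fin n ⊕ Fin n ≃ Fin (2 * n)) (w : ℕ → Bool),
      (∀ j : Fin (2 * n), w j = (π.symm j).isLeft) →
      ∃ s : ℕ, s + 2 * n₁ ≤ 2 * n ∧ Nat.count (fun k => w (s + k) = true) (2 * n₁) = n₁ := by
  intro n₁ n hn π w hw
  rcases Nat.eq_zero_or_pos n₁ with rfl | hpos
  · exact ⟨0, by simp, by simp⟩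
  -- `n = q n₁ + t` with `t < n₁ ≤ q`
  have hq : n₁ ≤ n / n₁ := (Nat.le_div_iff_mul_le hpos).mpr hn
  have hdiv : 2 * n / (2 * n₁) = n / n₁ := Nat.mul_div_mul_left n n₁ Nat.two_pos
  have hmod : 2 * n % (2 * n₁) = 2 * (n % n₁) := Nat.mul_mod_mul_left 2 n n₁
  have hn' : n₁ ≤ n := le_trans (Nat.le_mul_self n₁) hn
  have hsmall : (n₁ - 1) * (2 * n / (2 * n₁)) + min (2 * n % (2 * n₁)) (n₁ - 1) < n := by
    rw [hdiv, hmod]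
    have h1 : min (2 * (n % n₁)) (n₁ - 1) ≤ n₁ - 1 := min_le_right _ _
    have h2 : (n₁ - 1) * (n / n₁) + n₁ ≤ n₁ * (n / n₁) := by
      have : (n₁ - 1) * (n / n₁) + (n / n₁) = n₁ * (n / n₁) := by
        rw [← Nat.succ_mul, Nat.succ_eq_add_one, Nat.sub_add_cancel hpos]
      calc (n₁ - 1) * (n / n₁) + n₁ ≤ (n₁ - 1) * (n / n₁) + n / n₁ := by omega
        _ = n₁ * (n / n₁) := this
    have h3 : n₁ * (n / n₁) ≤ n := Nat.mul_div_le n n₁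
    omega
  obtain ⟨s, hs, hlo, hhi⟩ := exists_window_count_btwn (fun k => w k = true) (2 * n₁) (n₁ - 1) n
    (by omega) (by omega) hsmall (le_count_word_true n π w hw) (le_count_word_false n π w hw)
  exact ⟨s, hs, by omega⟩

end Summit.ValiantsHypothesis.ValiantsHypothesis.Theorems.LiouvilleSarnakLiouvilleCutRank.OneScale
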